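import Mathlib
import Summits.ValiantsHypothesis.ValiantsHypothesis.Theses.GirthSidon
import Summits.ValiantsHypothesis.ValiantsHypothesis.Theorems.GirthSidonPolySwallowForcesShortRelationTotallyBorn

/-!
# Crux `GirthSidon.PolySwallowForcesShortRelation` (stmt-ValiantsHypothesis-6537) — line `two_ended_honesty`

Skeleton line (crux-plan, planner `val-width-lines-2`, 2026-08-27).  POLYNOMIAL sources `y_j ∈ ℂ[x]` carry TWO
valuations that see the monomial targets `x^{d_i}`: the order at `0` (`natTrailingDegree`) and the order at `∞`
(`natDegree`).  With `V = span_ℂ(1, y_1, …, y_s)` (so `dim V ≤ s + 1`), `O₀ = ord₀(V ∖ 0)`, `O_∞ = deg(V ∖ 0)`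
(`|O₀| = |O_∞| = dim V`, echelon), every target `x^{d_i} = Γ_i(y) ∈ V·V` is either
HONEST at one end (`d_i ∈ O₀ + O₀` or `d_i ∈ O_∞ + O_∞` — the leading terms at that end do not cancel) or
DOUBLY BORN (leading cancellation at both ends).

* `stub_honestTargets` (PROVABLE NOW, size M): if every target is honest at `0` or at `∞`, the exponents are covered by
  the sumset `U + U`, `U = O₀ ∪ O_∞ ⊂ ℕ`, `|U| ≤ 2(s+1)`, and the tree's girth engine
  `Theorems.stub_coveringGirth` (dense core + Moore bound, `|U|^20 ≤ m^19`) yields a relation of length `≤ 30`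
  (non-injective `d` gives a length-1 relation outright).
* `stub_doublyBornTargets` (OPEN — the whole residual content of the crux, conjecture-grade): if every target is
  doubly born, a short relation still exists.  All recorded dense swallowers with many doubly-born monomials
  (generic `V ⊂ ℂ[x]_{≤Δ}` with `C(dim V + 1, 2) ≥ 2Δ + 1`, census S5 of `Cruxes/MomentCurveElusive/STRATEGY-CENSUS.md`;
  the cube/pencil gadgets of `LEAD-ANALYSIS-c5.md` §2(b)) have exponent sets that are intervals or generalised
  progressions, full of length-2 relations; no mechanism beyond that evidence is claimed.
* `PolySwallowForcesShortRelation_of` (KERNEL-CHECKED here): majority case split on honest vs doubly-born targets and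
  restriction to the larger class (`m' ≥ m/2`, whence `s^10 ≤ m^9 ≤ 512·m'^9`), re-indexing multisets along
  `Finset.orderEmbOfFin`.

RESHAPE (prover val-width-6537-p2, 2026-08-27): the honest/doubly-born split LEAKS in the prover's favour — a
doubly-born target may be CROSS-HONEST (`d_i ∈ O₀ + O_∞`), which the same sumset `U + U`, `U = O₀ ∪ O_∞`,
covers.  `Theorems.PolySwallowTotallyBorn.stub_doublyBornTargets_of_totallyBorn` (landed p576681) proves the
registered `stub_doublyBornTargets` from the strictly smaller TOTALLY-BORN residual `stub_totallyBornTargets`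
(`d_i ∉ (O₀ ∪ O_∞) + (O₀ ∪ O_∞)`, constant `2^18` after one more halving), which is now the line's only
open stub besides `stub_honestTargets` (itself ≤ 10 lines from
`Theorems.PolySwallowTotallyBorn.relation_of_orderDegreeCover 512`).
-/

set_option linter.dupNamespace false

namespace Summit.ValiantsHypothesis.ValiantsHypothesis.Cruxes.PolySwallowForcesShortRelation.TwoEndedHonesty

open Summit.ValiantsHypothesis.ValiantsHypothesis.Theses.GirthSidon

/-- The source space `V = span_ℂ(1, y_1, …, y_s) ⊂ ℂ[x]` of a polynomial swallower. -/
noncomputable def sourceSpan {s : ℕ} (y : Fin s → Polynomial ℂ) : Submodule ℂ (Polynomial ℂ) :=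
  Submodule.span ℂ (insert 1 (Set.range y))

/-- `d` is HONEST AT ZERO for the sources `y`: `d = ord₀ f + ord₀ g` for some nonzero `f, g ∈ V`
(`d ∈ O₀ + O₀`). -/
def HonestAtZero {s : ℕ} (y : Fin s → Polynomial ℂ) (d : ℕ) : Prop :=
  ∃ f ∈ sourceSpan y, ∃ g ∈ sourceSpan y, f ≠ 0 ∧ g ≠ 0 ∧ f.natTrailingDegree + g.natTrailingDegree = d

/-- `d` is HONEST AT INFINITY for the sources `y`: `d = deg f + deg g` for some nonzero `f, g ∈ V`
(`d ∈ O_∞ + O_∞`). -/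
def HonestAtInfty {s : ℕ} (y : Fin s → Polynomial ℂ) (d : ℕ) : Prop :=
  ∃ f ∈ sourceSpan y, ∃ g ∈ sourceSpan y, f ≠ 0 ∧ g ≠ 0 ∧ f.natDegree + g.natDegree = d

/-- **Stub 1 (provable now, M) — honest targets.**  If every target exponent is honest at `0` or at `∞`, a
relation of length `≤ 30` exists: `d(Fin m) ⊆ U + U` with `U = O₀ ∪ O_∞`, `|U| ≤ 2 (s + 1)` (two echelon counts),
`(2s+2)^20 ≤ m^19` for `m` large since `s^10 ≤ 512 m^9`, then `Theorems.stub_coveringGirth`; a non-injective `d`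
has the relation `{i} ≠ {j}`. [cite: BondySimonovits1974, Thm. 1] -/
theorem stub_honestTargets :
    ∃ m₀ : ℕ, ∀ m ≥ m₀, ∀ (d : Fin m → ℕ) (s : ℕ), s ^ 10 ≤ 512 * m ^ 9 →
      ∀ (Γ : Fin m → MvPolynomial (Fin s) ℂ) (y : Fin s → Polynomial ℂ),
        (∀ i, (Γ i).totalDegree ≤ 2) → (∀ i, MvPolynomial.aeval y (Γ i) = Polynomial.X ^ d i) →
        (∀ i, HonestAtZero y (d i) ∨ HonestAtInfty y (d i)) →
        ∃ S T : Multiset (Fin m), S ≠ T ∧ Multiset.card S ≤ 30 ∧ Multiset.card T ≤ 30 ∧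
          (S.map d).sum = (T.map d).sum := by
  sorry

/-- `d` is TOTALLY BORN for the sources `y`: it is not `ord f + ord g`, `ord f + deg g` or
`deg f + deg g` for any nonzero `f, g ∈ V` (`d ∉ (O₀ ∪ O_∞) + (O₀ ∪ O_∞)`); in particular it is doubly
born, and not even cross-honest. -/
def TotallyBorn {s : ℕ} (y : Fin s → Polynomial ℂ) (d : ℕ) : Prop :=
  ∀ f ∈ sourceSpan y, ∀ g ∈ sourceSpan y, f ≠ 0 → g ≠ 0 →
    d ≠ f.natTrailingDegree + g.natTrailingDegree ∧ d ≠ f.natTrailingDegree + g.natDegree ∧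
      d ≠ f.natDegree + g.natDegree

/-- **Stub 2' (OPEN, the residual after cross-honest absorption) — totally-born targets.**  If every
target `x^{d_i} = Γ_i(y)` is totally born (`d_i ∉ (O₀ ∪ O_∞) + (O₀ ∪ O_∞)`: leading cancellation at both
ends AND no mixed order-plus-degree representation) and `s^10 ≤ 2^18 m^9`, a relation of length `≤ 30`
still exists.  Conjecture-grade = the whole residual content of the crux.  Mechanisms on record producing
totally-born monomials: generic `V ⊂ ℂ[x]_{≤Δ}` with `dim V ≥ 11` (interval targets, relation-rich) and
ABSORBED `k`-NOMIALS (an interior term of a sparse source exposed by a monomial shift whose other terms land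
in `T + T`, `T` = monomial exponents of `V`; incidence graph (source, shift) ⇒ girth-capped like the toric
case).  Necessary for a counterexample: ≥ `m^{0.05}/2` terms per source on average (sparse engine 6539),
height `> m^{29}`-ish (pigeonhole), ≳ `m^{0.1}/4` non-monomial source dimensions (rank count).
[conjecture] -/
theorem stub_totallyBornTargets :
    ∃ m₀ : ℕ, ∀ m ≥ m₀, ∀ (d : Fin m → ℕ) (s : ℕ), s ^ 10 ≤ 262144 * m ^ 9 →
      ∀ (Γ : Fin m → MvPolynomial (Fin s) ℂ) (y : Fin s → Polynomial ℂ),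
        (∀ i, (Γ i).totalDegree ≤ 2) → (∀ i, MvPolynomial.aeval y (Γ i) = Polynomial.X ^ d i) →
        (∀ i, TotallyBorn y (d i)) →
        ∃ S T : Multiset (Fin m), S ≠ T ∧ Multiset.card S ≤ 30 ∧ Multiset.card T ≤ 30 ∧
          (S.map d).sum = (T.map d).sum := by
  sorry

/-- **Former stub 2 (now PROVED modulo stub 2') — doubly-born targets.**  If every target `x^{d_i} = Γ_i(y)` has leading
cancellation at BOTH ends (`d_i ∉ O₀ + O₀` and `d_i ∉ O_∞ + O_∞`), a relation of length `≤ 30` still exists.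
Conjecture-grade: beyond `s ≈ 6.68 √m` (Hilbert count) nothing is known for cancelling coordinates
(`Cruxes/MomentCurveElusive/LEAD-ANALYSIS-c3.md`, "first open rung").  Closed from `stub_totallyBornTargets` by the
landed reduction `Theorems.PolySwallowTotallyBorn.stub_doublyBornTargets_of_totallyBorn` (majority split:
cross-honest targets go to the girth engine). [folklore] -/
theorem stub_doublyBornTargets :
    ∃ m₀ : ℕ, ∀ m ≥ m₀, ∀ (d : Fin m → ℕ) (s : ℕ), s ^ 10 ≤ 512 * m ^ 9 →
      ∀ (Γ : Fin m → MvPolynomial (Fin s) ℂ) (y : Fin s → Polynomial ℂ),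
        (∀ i, (Γ i).totalDegree ≤ 2) → (∀ i, MvPolynomial.aeval y (Γ i) = Polynomial.X ^ d i) →
        (∀ i, ¬ HonestAtZero y (d i) ∧ ¬ HonestAtInfty y (d i)) →
        ∃ S T : Multiset (Fin m), S ≠ T ∧ Multiset.card S ≤ 30 ∧ Multiset.card T ≤ 30 ∧
          (S.map d).sum = (T.map d).sum :=
  Summit.ValiantsHypothesis.ValiantsHypothesis.Theorems.PolySwallowTotallyBorn.stub_doublyBornTargets_of_totallyBorn
    stub_totallyBornTargets

/-- Re-indexing: a short relation among `d ∘ e` along an injection `e : Fin m' ↪ Fin m` pushes forward to a short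
relation among `d`. [folklore] -/
theorem relation_of_embedding {m m' : ℕ} (d : Fin m → ℕ) (e : Fin m' ↪ Fin m)
    (h : ∃ S T : Multiset (Fin m'), S ≠ T ∧ Multiset.card S ≤ 30 ∧ Multiset.card T ≤ 30 ∧
        (S.map (d ∘ e)).sum = (T.map (d ∘ e)).sum) :
    ∃ S T : Multiset (Fin m), S ≠ T ∧ Multiset.card S ≤ 30 ∧ Multiset.card T ≤ 30 ∧
        (S.map d).sum = (T.map d).sum := by
  obtain ⟨S, T, hne, hS, hT, hsum⟩ := h
  refine ⟨S.map e, T.map e, ?_, by simpa using hS, by simpa using hT, ?_⟩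
  · exact fun heq => hne (Multiset.map_injective e.injective heq)
  · simpa [Multiset.map_map] using hsum

/-- Restriction of a swallowing to a set `I` of target indices, keeping the sources. [folklore] -/
theorem relation_of_restrict {m : ℕ} (d : Fin m → ℕ) (s : ℕ) (Γ : Fin m → MvPolynomial (Fin s) ℂ)
    (y : Fin s → Polynomial ℂ) (hΓ : ∀ i, (Γ i).totalDegree ≤ 2)
    (hy : ∀ i, MvPolynomial.aeval y (Γ i) = Polynomial.X ^ d i)
    (I : Finset (Fin m)) (P : ∀ {s' : ℕ}, (Fin s' → Polynomial ℂ) → ℕ → Prop) (hI : ∀ i ∈ I, P y (d i))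
    (m₀ : ℕ) (hm₀ : m₀ ≤ I.card)
    (hs : s ^ 10 ≤ 512 * I.card ^ 9)
    (h : ∀ m' ≥ m₀, ∀ (d' : Fin m' → ℕ) (s' : ℕ), s' ^ 10 ≤ 512 * m' ^ 9 →
      ∀ (Γ' : Fin m' → MvPolynomial (Fin s') ℂ) (y' : Fin s' → Polynomial ℂ),
        (∀ i, (Γ' i).totalDegree ≤ 2) → (∀ i, MvPolynomial.aeval y' (Γ' i) = Polynomial.X ^ d' i) →
        (∀ i, P y' (d' i)) →
        ∃ S T : Multiset (Fin m'), S ≠ T ∧ Multiset.card S ≤ 30 ∧ Multiset.card T ≤ 30 ∧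
          (S.map d').sum = (T.map d').sum) :
    ∃ S T : Multiset (Fin m), S ≠ T ∧ Multiset.card S ≤ 30 ∧ Multiset.card T ≤ 30 ∧
        (S.map d).sum = (T.map d).sum := by
  let e : Fin I.card ↪ Fin m := (I.orderEmbOfFin rfl).toEmbedding
  have he : ∀ i, e i ∈ I := fun i => I.orderEmbOfFin_mem rfl i
  exact relation_of_embedding d e
    (h I.card hm₀ (d ∘ e) s hs (Γ ∘ e) y (fun i => hΓ (e i)) (fun i => hy (e i)) (fun i => hI (e i) (he i)))

/-- **Composition (kernel-checked).**  Stub 1 + Stub 2 ⇒ the crux: split the targets into the honest ones and the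
doubly-born ones; the larger class has `m' ≥ m/2` elements, so `s^10 ≤ m^9 ≤ 512 m'^9`, and the relation found inside it
is a relation among the original exponents.  The two registered stubs are used by name. [folklore] -/
theorem PolySwallowForcesShortRelation_of : PolySwallowForcesShortRelation := by
  obtain ⟨mA, hA⟩ := stub_honestTargets
  obtain ⟨mB, hB⟩ := stub_doublyBornTargets
  refine ⟨2 * (mA + mB), fun m hm d s hs Γ y hΓ hy => ?_⟩
  classical
  let H : Finset (Fin m) := Finset.univ.filter fun i => HonestAtZero y (d i) ∨ HonestAtInfty y (d i)
  have hcard : H.card + Hᶜ.card = m := by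
    rw [Finset.card_compl, Fintype.card_fin]
    have : H.card ≤ m := le_trans (Finset.card_le_univ H) (by simp)
    omega
  -- from `2 * c ≥ m` we get the numeric side conditions for a class of size `c`
  have num : ∀ c : ℕ, m ≤ 2 * c → s ^ 10 ≤ 512 * c ^ 9 := by
    intro c hc
    calc s ^ 10 ≤ m ^ 9 := hs
      _ ≤ (2 * c) ^ 9 := Nat.pow_le_pow_left hc 9
      _ = 512 * c ^ 9 := by ring
  by_cases hmaj : m ≤ 2 * H.card
  · exact relation_of_restrict d s Γ y hΓ hy H (fun y' n => HonestAtZero y' n ∨ HonestAtInfty y' n)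
      (fun i hi => (Finset.mem_filter.mp hi).2) mA (by omega) (num H.card hmaj) hA
  · exact relation_of_restrict d s Γ y hΓ hy Hᶜ (fun y' n => ¬ HonestAtZero y' n ∧ ¬ HonestAtInfty y' n)
      (fun i hi => not_or.mp fun h' => (Finset.mem_compl.mp hi) (Finset.mem_filter.mpr ⟨Finset.mem_univ _, h'⟩))
      mB (by omega) (num Hᶜ.card (by omega)) hB

end Summit.ValiantsHypothesis.ValiantsHypothesis.Cruxes.PolySwallowForcesShortRelation.TwoEndedHonesty
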